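import Mathlib.Analysis.InnerProductSpace.PiL2
import Literature.Geometry.DiscreteGeometry.TammesThirteen
import Summits.AtomisticToContinuum.Crystallization.Theorems.PricedLinkCensusTruncatedCensusGapNoOvercoordinationOfGappedKissing
import HarnessLib

/-!
# The 1 %-gapped kissing bound and no over-coordination, modulo Tammes-13 (crux `TruncatedCensusGap`, line `birth`)

Route `PricedLinkCensus`, crux `TruncatedCensusGap` (stmt-AtomisticToContinuum-14230), line `birth`
(census split, `Cruxes/TruncatedCensusGap/Lines/birth.lean`), lead c4.  Stub (O1)
`stub_gappedKissingOnePercent` of the skeleton — every finite set of unit vectors of `ℝ³` with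
pairwise distances `≥ 100/101` has at most twelve elements — is, CONDITIONALLY on the named fact
`Literature.Geometry.DiscreteGeometry.musinTarasov2012_tammes_thirteen` (Tammes `N = 13`, chordal
threshold `0.957 < 100/101`), one application; composed with the landed bond-graph reduction
`stub_noOvercoordination_of_gappedKissing` (p141737) it gives stub (O) of the planner's census:
no site of an injective configuration has more than twelve bonds at tolerance `1/100`.  The
unconditional (O1) is the lead's own stub (Musin's LP-with-cap method at `arccos(5201/10201)`).
-/

noncomputable section

namespace Summit.AtomisticToContinuum.Crystallization.Theorems.PricedLinkCensusTruncatedCensusGap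

open Literature.Geometry.DiscreteGeometry

/-- **(O1) modulo Tammes-13.** Unit vectors of `ℝ³` pairwise at distance `≥ 100/101` number at most
twelve, assuming `musinTarasov2012_tammes_thirteen` (threshold `0.957 ≤ 100/101`). [folklore] -/
theorem gappedKissingOnePercent_of_tammes13 : Literature.Geometry.DiscreteGeometry.musinTarasov2012_tammes_thirteen → ∀ T : Finset (EuclideanSpace ℝ (Fin 3)), (∀ v ∈ T, ‖v‖ = 1) → (∀ v ∈ T, ∀ w ∈ T, v ≠ w → (100 / 101 : ℝ) ≤ dist v w) → T.card ≤ 12 :=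
  fun hT T hT1 hd => card_le_twelve_of_tammes_thirteen hT T hT1 (by norm_num) hd

/-- **(O) modulo Tammes-13.** In the scale-free bond graph at tolerance `1/100` of an injective finite
configuration of `ℝ³`, every site has at most twelve bonds, assuming
`musinTarasov2012_tammes_thirteen`. [folklore] -/
theorem noOvercoordination_of_tammes13 : Literature.Geometry.DiscreteGeometry.musinTarasov2012_tammes_thirteen → ∀ (N : ℕ) (y : Fin N → EuclideanSpace ℝ (Fin 3)), Function.Injective y → ∀ i : Fin N, ((Literature.Geometry.DiscreteGeometry.bondGraph (1 / 100 : ℝ) y).neighborSet i).ncard ≤ 12 :=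
  fun hT => stub_noOvercoordination_of_gappedKissing (gappedKissingOnePercent_of_tammes13 hT)

end Summit.AtomisticToContinuum.Crystallization.Theorems.PricedLinkCensusTruncatedCensusGap

end
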